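import Mathlib
import Summits.BirchSwinnertonDyer.BirchSwinnertonDyer.Theorems.ResidualThetaTransportAtTwoSignedMuSeedAtTwoPlusNonsquareDescentIwasawaKernel
import HarnessLib

/-!
# Non-square descent — IWASAWA'S KERNEL IN THE LIMIT, ENDOMORPHISM FORM: `ker π_k = T(X)` for a compatible family of level endomorphisms
# `T_i` («`σ − 1`») instead of a scalar `ω ∈ R`, and the idempotent cut (`χ`-parts) of `ker N = (σ−1)A` (line `nonsquare-descent`, stub S2) —
# seed crux `SignedMuSeedAtTwoPlus` stmt-BirchSwinnertonDyer-21438 (parent Kμ⁺ `SignedMuVanishingAtTwoPlus` stmt-BirchSwinnertonDyer-20689,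
# route ResidualThetaTransportAtTwo), line card `Cruxes/SignedMuSeedAtTwoPlus/Lines/nonsquare-descent.md`

Cell `bsd-wall`, width seat `bsd-wall-rtt-p4-w2` g20 (`--supports`, closes nothing).  THEOREMS ONLY; BSD is not proved by this and nothing
arithmetic is asserted: module algebra over a commutative ring (any `R`, e.g. `ℤ` or `ℤ₂`: NO `Λ'`-module structure is presupposed).

Sequel of `…NonsquareDescentIwasawaKernel` (scalar `ω`).  The tree's finite-level theorem
`Literature.NumberTheory.NumberFields.ClassGroupNormKernel.exists_primary_eq_div_of_classGroupNorm_eq_one` delivers, at each pair of layers,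
`ker(N : A_j → A_k) = (σ_k − 1) A_j` with `σ_k − 1` an ENDOMORPHISM of the level (the Galois action), before any `Λ'`-module structure making it the
scalar `ω_k` is built.  This file runs the same König argument with a family of level endomorphisms `T i : E i → E i` commuting with the norms:

* §1 `finite_solutions_of_finite_ker` (torsor), **`exists_coherent_endo_eq`** — KÖNIG for an endomorphism family: a norm-coherent `x` with
  `x i ∈ T_i(E i)` for all `i` (finite kernels `ker T_i`) is `(T_i y_i)_i` for a norm-COHERENT `y` (Mathlib `nonempty_sections_of_finite_inverse_system`).
* §2 **`ker_proj_eq_range_of_endo`** — `X` a compatible complete jointly-injective limit with `T∞` over the `T_i` (`π i ∘ T∞ = T_i ∘ π i`):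
  `ker (Nc j k) ≤ T_j(E j)` for `j ≥ k` and `T_k = 0` ⟹ `ker (π k) = T∞(X)`.
* §3 **`ker_inf_range_eq_of_idempotent`** — the `χ`-part (or `p`-part) cut: if `ker N = range T` on `A` and an idempotent `e` commutes with `T` and is
  respected by `N` (`N ∘ e = e' ∘ N`), then `ker N ⊓ e(A) = T(e(A))` («`ker(A^χ_j → A^χ_k) = (σ−1) A^χ_j`»).

[folklore]
-/

set_option autoImplicit false
-- the Theorems namespace of this sub repeats the summit name by design (D-0017 nested layout)
set_option linter.dupNamespace false

open CategoryTheory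

namespace Summit.BirchSwinnertonDyer.BirchSwinnertonDyer.Theorems.SignedMuAtTwo.NonsquareDescent

universe u v w

variable {R : Type u} [CommRing R] (E : ℕ → Type v) [∀ i, AddCommGroup (E i)] [∀ i, Module R (E i)]
  (N : ∀ i, E (i + 1) →ₗ[R] E i) (Nc : ∀ j i, E j →ₗ[R] E i) (T : ∀ i, E i →ₗ[R] E i)

/-! ## §1 König for an endomorphism family -/

section Koenig

omit N Nc in
/-- The solution set `{y : T y = x}` is finite when `ker T` is (a torsor, or empty). [folklore] -/
theorem finite_solutions_of_finite_ker {M : Type*} [AddCommGroup M] [Module R M] (f : M →ₗ[R] M)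
    (hfin : Finite {y : M // f y = 0}) (x : M) : Finite {y : M // f y = x} := by
  by_cases hsol : ∃ y₀ : M, f y₀ = x
  · obtain ⟨y₀, hy₀⟩ := hsol
    refine Finite.of_injective
      (fun y : {y : M // f y = x} => (⟨y.1 - y₀, by rw [map_sub, y.2, hy₀, sub_self]⟩ : {y : M // f y = 0})) fun y y' h => ?_
    have h1 := congrArg Subtype.val h
    exact Subtype.ext (sub_left_injective h1)
  · haveI : IsEmpty {y : M // f y = x} := ⟨fun y => hsol ⟨y.1, y.2⟩⟩
    infer_instance

omit Nc in
/-- **König for an endomorphism family.**  Along a tower `N i : E (i+1) → E i` with level endomorphisms `T i` commuting with the norms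
(`N i ∘ T (i+1) = T i ∘ N i`) and finite kernels `ker T_i`, a norm-coherent `x` with `x i ∈ T_i(E i)` for every `i` is `(T_i (y i))_i` for a
norm-COHERENT `y`: the solution sets `{y : T_i y = x i}` form an inverse system of finite non-empty sets (Mathlib
`nonempty_sections_of_finite_inverse_system`). [folklore] -/
theorem exists_coherent_endo_eq (hTN : ∀ i (y : E (i + 1)), N i (T (i + 1) y) = T i (N i y))
    (hfin : ∀ i, Finite {y : E i // T i y = 0}) (x : ∀ i, E i) (hx : ∀ i, N i (x (i + 1)) = x i)
    (hsol : ∀ i, ∃ y : E i, T i y = x i) :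
    ∃ y : ∀ i, E i, (∀ i, N i (y (i + 1)) = y i) ∧ ∀ i, T i (y i) = x i := by
  classical
  let X : ℕ → Type v := fun i => {y : E i // T i y = x i}
  let f : ∀ i, (X (i + 1) ⟶ X i) := fun i =>
    TypeCat.ofHom fun y => ⟨N i y.1, by rw [← hTN, y.2, hx]⟩
  haveI hne : ∀ i, Nonempty (X i) := fun i => by
    obtain ⟨y, hy⟩ := hsol i
    exact ⟨⟨y, hy⟩⟩
  haveI hfi : ∀ i, Finite (X i) := fun i => finite_solutions_of_finite_ker (T i) (hfin i) (x i)
  haveI : ∀ j : ℕᵒᵖ, Nonempty ((Functor.ofOpSequence f).obj j) := fun j => hne j.unop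
  haveI : ∀ j : ℕᵒᵖ, Finite ((Functor.ofOpSequence f).obj j) := fun j => hfi j.unop
  obtain ⟨s, hs⟩ := nonempty_sections_of_finite_inverse_system (Functor.ofOpSequence f)
  have hs' : ∀ i, (f i) (s (Opposite.op (i + 1))) = s (Opposite.op i) := fun i => by
    have h1 := hs (homOfLE (Nat.le_add_right i 1)).op
    rwa [Functor.ofOpSequence_map_homOfLE_succ] at h1
  exact ⟨fun i => (s (Opposite.op i)).1, fun i => congrArg Subtype.val (hs' i), fun i => (s (Opposite.op i)).2⟩

end Koenig

/-! ## §2 `ker π_k = T∞(X)` -/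

section Limit

variable {Einf : Type w} [AddCommGroup Einf] [Module R Einf] (π : ∀ i, Einf →ₗ[R] E i) (Tinf : Einf →ₗ[R] Einf)

/-- **`ker π_k = T∞(X)`, endomorphism form of Iwasawa's kernel in the limit.**  `X = Einf` a compatible (`hπ`), complete (`hlift`), jointly
injective (`hinj`) limit; `T_i` level endomorphisms commuting with the norms, with finite kernels, lifted to `T∞` on `X` (`π i ∘ T∞ = T_i ∘ π i`).
If `ker (Nc j k) ≤ T_j(E j)` for all `j ≥ k` (the finite-level theorem «`ker(A_j → A_k) = (σ_k − 1)A_j`», tree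
`ClassGroupNormKernel.exists_primary_eq_div_of_classGroupNorm_eq_one`) and `T_k = 0` (`σ_k` acts trivially on `A_k`), then `ker (π k) = T∞(X)` —
`A_k ≅ X/(σ_k − 1)X` with no `Λ'`-module structure needed. [cite: Washington1997, §13.3 Lemma 13.15 and Prop. 13.22] [folklore] -/
theorem ker_proj_eq_range_of_endo (hNc0 : ∀ j, Nc j j = LinearMap.id)
    (hNcS : ∀ j i, i ≤ j → Nc (j + 1) i = Nc j i ∘ₗ N j) (hπ : ∀ i e, N i (π (i + 1) e) = π i e)
    (hlift : ∀ x : ∀ i, E i, (∀ i, N i (x (i + 1)) = x i) → ∃ e : Einf, ∀ i, π i e = x i)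
    (hinj : ∀ e : Einf, (∀ i, π i e = 0) → e = 0)
    (hTN : ∀ i (y : E (i + 1)), N i (T (i + 1) y) = T i (N i y)) (hfin : ∀ i, Finite {y : E i // T i y = 0})
    (hTinf : ∀ i (e : Einf), π i (Tinf e) = T i (π i e)) (k : ℕ)
    (hker : ∀ j, k ≤ j → ∀ y : E j, Nc j k y = 0 → ∃ b : E j, T j b = y) (hTk : ∀ y : E k, T k y = 0) :
    LinearMap.ker (π k) = LinearMap.range Tinf := by
  apply le_antisymm
  · intro x hx
    rw [LinearMap.mem_ker] at hx
    have hsol : ∀ j, ∃ b : E j, T j b = π j x := by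
      intro j
      rcases le_or_gt k j with hkj | hjk
      · exact hker j hkj (π j x) (by rw [Nc_proj_eq E N Nc π hNc0 hNcS hπ x hkj, hx])
      · exact ⟨0, by rw [map_zero, ← Nc_proj_eq E N Nc π hNc0 hNcS hπ x hjk.le, hx, map_zero]⟩
    obtain ⟨b, hbN, hb⟩ := exists_coherent_endo_eq E N T hTN hfin (fun j => π j x) (fun i => hπ i x) hsol
    obtain ⟨y, hy⟩ := hlift b hbN
    have hxy : x = Tinf y := by
      rw [← sub_eq_zero]
      refine hinj _ fun i => ?_
      rw [map_sub, hTinf, hy i, hb i, sub_self]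
    exact ⟨y, hxy.symm⟩
  · rintro _ ⟨y, rfl⟩
    rw [LinearMap.mem_ker, hTinf, hTk]

end Limit

/-! ## §3 The idempotent cut -/

section Idempotent

variable {A : Type v} [AddCommGroup A] [Module R A] {B : Type w} [AddCommGroup B] [Module R B]

omit E N Nc T in
/-- **The `χ`-part (idempotent) cut of `ker N = T(A)`.**  `N : A → B`, `T : A → A` with `ker N = range T`; `e` an idempotent endomorphism of `A`
commuting with `T`, and `e'` an endomorphism of `B` with `N ∘ e = e' ∘ N` (not even needed).  Then `ker N ⊓ e(A) = T(e(A))`: for `x = e x` with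
`N x = 0`, `x = T y` gives `x = e T y = T (e y)`. («`ker(A_j^χ → A_k^χ) = (σ − 1)A_j^χ`», `e = e_χ`, or the `p`-part idempotent.) [folklore] -/
theorem ker_inf_range_eq_of_idempotent (Nm : A →ₗ[R] B) (Tm e : A →ₗ[R] A) (hker : LinearMap.ker Nm = LinearMap.range Tm)
    (he : e ∘ₗ e = e) (hcomm : e ∘ₗ Tm = Tm ∘ₗ e) :
    LinearMap.ker Nm ⊓ LinearMap.range e = LinearMap.range (Tm ∘ₗ e) := by
  apply le_antisymm
  · rintro x ⟨hxN, ⟨z, rfl⟩⟩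
    have hx : e z ∈ LinearMap.range Tm := by rw [← hker]; exact hxN
    obtain ⟨y, hy⟩ := hx
    refine ⟨y, ?_⟩
    have hez : e (e z) = e z := by rw [← LinearMap.comp_apply, he]
    rw [LinearMap.comp_apply, ← LinearMap.comp_apply, ← hcomm, LinearMap.comp_apply, hy, hez]
  · rintro _ ⟨y, rfl⟩
    refine ⟨?_, ?_⟩
    · rw [SetLike.mem_coe, hker]; exact ⟨e y, rfl⟩
    · rw [LinearMap.comp_apply, ← LinearMap.comp_apply, ← hcomm, LinearMap.comp_apply]
      exact ⟨Tm y, rfl⟩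

omit E N Nc T in
/-- The same cut read on elements of `e(A)`: for `x ∈ e(A)`, `N x = 0 ↔ ∃ y ∈ e(A), T y = x`. [folklore] -/
theorem eq_zero_iff_exists_of_idempotent (Nm : A →ₗ[R] B) (Tm e : A →ₗ[R] A) (hker : LinearMap.ker Nm = LinearMap.range Tm)
    (he : e ∘ₗ e = e) (hcomm : e ∘ₗ Tm = Tm ∘ₗ e) {x : A} (hx : x ∈ LinearMap.range e) :
    Nm x = 0 ↔ ∃ y ∈ LinearMap.range e, Tm y = x := by
  have h := ker_inf_range_eq_of_idempotent Nm Tm e hker he hcomm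
  constructor
  · intro hN
    have hmem : x ∈ LinearMap.ker Nm ⊓ LinearMap.range e := ⟨hN, hx⟩
    rw [h] at hmem
    obtain ⟨z, rfl⟩ := hmem
    exact ⟨e z, ⟨z, rfl⟩, rfl⟩
  · rintro ⟨y, ⟨z, rfl⟩, rfl⟩
    have hmem : Tm (e z) ∈ LinearMap.ker Nm ⊓ LinearMap.range e := by rw [h]; exact ⟨z, rfl⟩
    exact hmem.1

end Idempotent

end Summit.BirchSwinnertonDyer.BirchSwinnertonDyer.Theorems.SignedMuAtTwo.NonsquareDescent
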